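import Summits.AtomisticToContinuum.HydrodynamicLimit.Theorems.CorrectorPressureDecay.Negative.DiscreteWindowOfCorrector
import Summits.AtomisticToContinuum.HydrodynamicLimit.Theorems.CorrectorPressureDecay.Negative.WindowComparison
import Summits.AtomisticToContinuum.HydrodynamicLimit.Theorems.AntiMazurCoboundariesCorrectorPressureDecayEntropyBudget

/-!
# Negative knowledge for `CorrectorPressureDecay` (stmt-AtomisticToContinuum-14135): the shared wall 10967 implies
discrete-window pressure decay (drefute gen 3, file 4/4)

Refuter `refuter-drefute-stmt-AtomisticToContinuum-14135-g3-0`, 2026-08-16. WHAT IS PROVED (sorry-free):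

  `discreteWindowPressureDecay_of_kineticFluxLdDecay : KineticFluxLdDecay → DiscreteWindowPressureDecay`

(`KineticFluxLdDecay` = stmt-AtomisticToContinuum-10967 BY NAME; `DiscreteWindowPressureDecay` = drefute gen 2's statement
in `Negative/FastSectorSandwichFrame.lean`). This was the PAPER step (i) of drefute gen 2's sandwich; now the chain
`10967 ⇒ DWPD ⇒ stub_fastSectorDominance` is a Lean theorem modulo the true stub 2
(`fastSectorDominance_of_discreteWindowPressureDecay`), and with the landed stub 6 `stub_discreteFejerCorrector` (DWPD ⇒ X)
and `pressureCertificateTransfer_proof` (X ⇒ 10967) the two cruxes stmt-14135 (`CorrectorPressureDecay`) and stmt-10967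
are EQUIVALENT by composing kernel-checked theorems: X is the wall in corrector clothing, nothing more and nothing less.

MECHANISM (no Riemann sums, no subadditivity): apply 10967 to the admissible observable `4g` at `δ := η/2` (window `τ`,
threshold `N₀`), put `H₁ := max τ (2κτ/η)`; for `H ≥ H₁`: the long-window lemma of file 3/4 on the modified flow
`flowMod Φ` gives `∫ exp(4 Ā_{Hℓ_N}) dG_N ≤ e^{(N+1)κτ/H} e^{η(N+1)/2} ≤ e^{η(N+1)}`; for `n ≥ n₀(N, Φ)` (`Hℓ_N/n ≤ u₁`, the
Koopman tolerance of file 2/4) the discrete average is `L¹(G_N)`-close to `Ā_{Hℓ_N}`, `∫ e^{4(A_n − Ā)} ≤ e^{η(N+1)}`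
(`∫e^Y ≤ 1 + e^B∫|Y|`), and Cauchy–Schwarz assembles `∫ exp(2A_n) dG_N ≤ e^{η(N+1)}`. Nothing here asserts a Theses decl.
-/

noncomputable section

open MeasureTheory ProbabilityTheory InformationTheory Set Filter Topology
open scoped ENNReal

namespace Summit.AtomisticToContinuum.HydrodynamicLimit.Theorems.CorrectorPressureDecayNegative.DiscreteWindow

open Literature.MathematicalPhysics.KineticTheory (T3 V3 hsDiameter localGibbsLaw)
open Literature.Analysis.FluidPDE (HardSphereFlow Config)
open Summit.AtomisticToContinuum.HydrodynamicLimit.Theorems.CorrectorPressureDecayNegative.FastSectorSandwich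
open Summit.AtomisticToContinuum.HydrodynamicLimit.Theorems.BoltzmannGreenKuboOrthMomentum
  (flowMod flowMod_of_mem measurable_flowMod)
open Summit.AtomisticToContinuum.HydrodynamicLimit.Theorems.AntiMazurCoboundariesExponentialCertificate
  (flowMod_add measurePreserving_flowMod intervalIntegrable_of_bounded measurable_intervalIntegral_comp)

/-! ## The wall implies discrete-window pressure decay -/

section Main

variable {σ : ℝ} {N : ℕ}

set_option maxHeartbeats 1600000 in
/-- **10967 ⇒ discrete-window pressure decay.** `KineticFluxLdDecay` (stmt-10967, BY NAME) implies
`DiscreteWindowPressureDecay` at amplitude `κ/4`: apply 10967 to the admissible observable `4g` at `δ := η/2`, giving a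
window `τ` and `N₀`; put `H₁ := max τ (2κτ/η)`. For `H ≥ H₁`, `N ≥ N₀` and a flow: the long-window lemma turns the
`τℓ_N`-window bound into `∫ exp(4Ā_{Hℓ_N}) dG_N ≤ e^{η(N+1)}` (remainder factor `e^{(N+1)κτ/H} ≤ e^{η(N+1)/2}`); for
`n ≥ n₀(N, Φ)` the discrete average `A_n` is `L¹(G_N)`-close to `Ā_{Hℓ_N}` (right-continuity of the Koopman shift), so
`∫ e^{4(A_n − Ā)} ≤ e^{η(N+1)}`, and Cauchy–Schwarz gives `∫ exp(2A_n) dG_N ≤ e^{η(N+1)}`. [folklore] -/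
theorem discreteWindowPressureDecay_of_kineticFluxLdDecay
    (h : Summit.AtomisticToContinuum.HydrodynamicLimit.Theses.AntiMazurCoboundaries.KineticFluxLdDecay) :
    DiscreteWindowPressureDecay := by
  intro a θ u₀ ha hθ
  obtain ⟨σ₀, hσ₀, H⟩ := h a θ u₀ ha hθ
  refine ⟨σ₀, hσ₀, fun σ hσ hσlt => ?_⟩
  obtain ⟨hP, κ, hκ, Hκ⟩ := H σ hσ hσlt
  refine ⟨κ / 4, by positivity, fun φ g hφ hg hφ1 hgκ horth η hη => ?_⟩
  -- the wall for the admissible observable `4g` at `δ := η/2`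
  have hg4c : Continuous fun v => 4 * g v := continuous_const.mul hg
  have hg4b : ∀ v, |4 * g v| ≤ κ := fun v => by
    rw [abs_mul, abs_of_pos (by norm_num : (0 : ℝ) < 4)]
    linarith [hgκ v]
  have hη2 : 0 < η / 2 := by positivity
  obtain ⟨τ, hτ, N₀, HN⟩ := Hκ φ (fun v => 4 * g v) hφ hg4c hφ1 hg4b (orth_const_mul horth 4) (η / 2) hη2
  refine ⟨max τ (2 * κ * τ / η), lt_max_of_lt_left hτ, fun Hw hHw => ⟨N₀, fun N hN Φ => ?_⟩⟩
  have hHτ : τ ≤ Hw := (le_max_left _ _).trans hHw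
  have hHκ : 2 * κ * τ / η ≤ Hw := (le_max_right _ _).trans hHw
  have hHpos : 0 < Hw := hτ.trans_le hHτ
  -- frame objects at fixed `(N, Φ)`
  haveI hGp : IsProbabilityMeasure (gibbs σ a θ u₀ N Φ) := hP N Φ
  have hinv : ∀ t, MeasurePreserving (Φ.flow t) (gibbs σ a θ u₀ N Φ) (gibbs σ a θ u₀ N Φ) := fun t =>
    measurePreserving_flow_localGibbsLaw_const σ a θ u₀ N Φ t
  have hgood : gibbs σ a θ u₀ N Φ Φ.goodᶜ = 0 := by
    have hac : gibbs σ a θ u₀ N Φ ≪ Literature.Analysis.FluidPDE.liouville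
        (Literature.Analysis.FluidPDE.Torus.geometry (Fin 3)) (N + 1) (hsDiameter σ N) := by
      show localGibbsLaw σ _ _ _ N Φ ≪ _
      rw [Literature.MathematicalPhysics.KineticTheory.localGibbsLaw_eq]
      exact Literature.MathematicalPhysics.KineticTheory.localGibbsMeasure_absolutelyContinuous σ _ _ _ N Φ
    exact hac Φ.measure_compl_good
  set G : Measure (Phase N) := gibbs σ a θ u₀ N Φ with hGdef
  have hae : ∀ᵐ z ∂G, z ∈ Φ.good := (mem_ae_iff.2 hgood : Φ.good ∈ ae G)
  set ℓ : ℝ := scale N with hℓdef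
  have hℓ : 0 < ℓ := Real.rpow_pos_of_pos (by positivity) _
  set T : ℝ := Hw * ℓ with hTdef
  have hT : 0 < T := mul_pos hHpos hℓ
  set L : ℝ := τ * ℓ with hLdef
  have hL : 0 < L := mul_pos hτ hℓ
  have hLT : L ≤ T := mul_le_mul_of_nonneg_right hHτ hℓ.le
  set F : Phase N → ℝ := fluxObs θ u₀ φ g N with hFdef
  have hFc : Continuous F := continuous_fluxObs hφ hg N
  have hFm : Measurable F := measurable_fluxObs hφ hg N
  have hFb : ∀ z, |F z| ≤ (N + 1) * (κ / 4) := abs_fluxObs_le hφ1 hgκ N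
  set F₄ : Phase N → ℝ := fluxObs θ u₀ φ (fun v => 4 * g v) N with hF₄def
  have hF4m : Measurable F₄ := measurable_fluxObs hφ hg4c N
  have hF4b : ∀ z, |F₄ z| ≤ (N + 1) * κ := abs_fluxObs_le hφ1 hg4b N
  have hF4eq : ∀ z, F₄ z = 4 * F z := fun z => fluxObs_const_mul θ u₀ φ g 4 N z
  -- the modified flow
  have hθm : Measurable (flowMod Φ) := measurable_flowMod Φ
  have hθmt : ∀ t, Measurable fun z => flowMod Φ (t, z) := fun t => hθm.comp measurable_prodMk_left
  have hinvm : ∀ t, MeasurePreserving (fun z => flowMod Φ (t, z)) G G := measurePreserving_flowMod Φ G hinv hgood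
  -- (1) the wall's window bound, on the modified flow
  set E : ℝ≥0∞ := ENNReal.ofReal (Real.exp (η * (N + 1))) with hEdef
  set Eh : ℝ≥0∞ := ENNReal.ofReal (Real.exp (η / 2 * (N + 1))) with hEhdef
  have h10967 : ∫⁻ z, ENNReal.ofReal (Real.exp (L⁻¹ * ∫ s in (0 : ℝ)..L, F₄ (Φ.flow s z))) ∂G ≤ Eh := HN N hN Φ
  have hKL : ∫⁻ z, ENNReal.ofReal (Real.exp (L⁻¹ * ∫ s in (0 : ℝ)..L, F₄ (flowMod Φ (s, z)))) ∂G ≤ Eh := by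
    refine le_of_eq_of_le (lintegral_congr_ae ?_) h10967
    filter_upwards [hae] with z hz
    simp only [flowMod_of_mem Φ hz]
  -- (2) long windows
  have hEh1 : 1 ≤ Eh := ENNReal.one_le_ofReal.2 (Real.one_le_exp (by positivity))
  have hKT := lintegral_exp_window_le_of_short (flowMod Φ) hθm (flowMod_add Φ) G hinvm hF4m hF4b hL hLT hEh1 hKL
  have hrem : ENNReal.ofReal (Real.exp ((N + 1) * κ * L / T)) * Eh ≤ E := by
    rw [hEhdef, hEdef, ← ENNReal.ofReal_mul (Real.exp_nonneg _), ← Real.exp_add]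
    refine ENNReal.ofReal_le_ofReal (Real.exp_le_exp.2 ?_)
    have hN1 : (0 : ℝ) < N + 1 := by positivity
    have h1 : κ * L / T ≤ η / 2 := by
      rw [hLdef, hTdef, div_le_iff₀ hT]
      have h2 : 2 * κ * τ ≤ Hw * η := by rwa [div_le_iff₀ hη] at hHκ
      nlinarith [mul_le_mul_of_nonneg_right h2 hℓ.le]
    have h3 : (N + 1) * κ * L / T = (N + 1) * (κ * L / T) := by ring
    rw [h3]
    nlinarith [mul_le_mul_of_nonneg_left h1 hN1.le]
  set Abar : Phase N → ℝ := fun z => T⁻¹ * ∫ s in (0 : ℝ)..T, F (flowMod Φ (s, z)) with hAbardef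
  have hAbarm : Measurable Abar := (measurable_intervalIntegral_comp (flowMod Φ) hθm hFm hT.le).const_mul _
  have hAbarb : ∀ z, |Abar z| ≤ (N + 1) * (κ / 4) := by
    intro z
    have h1 : ‖∫ s in (0 : ℝ)..T, F (flowMod Φ (s, z))‖ ≤ (N + 1) * (κ / 4) * |T - 0| :=
      intervalIntegral.norm_integral_le_of_norm_le_const fun s _ => by
        rw [Real.norm_eq_abs]; exact hFb _
    rw [Real.norm_eq_abs, sub_zero, abs_of_pos hT] at h1
    rw [hAbardef]
    simp only
    rw [abs_mul, abs_of_pos (inv_pos.2 hT)]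
    calc T⁻¹ * |∫ s in (0 : ℝ)..T, F (flowMod Φ (s, z))| ≤ T⁻¹ * ((N + 1) * (κ / 4) * T) :=
          mul_le_mul_of_nonneg_left h1 (inv_pos.2 hT).le
      _ = (N + 1) * (κ / 4) := by rw [mul_comm, mul_assoc, mul_inv_cancel₀ hT.ne', mul_one]
  have hA4 : ∫⁻ z, ENNReal.ofReal (Real.exp (4 * Abar z)) ∂G ≤ E := by
    have e1 : ∀ z, 4 * Abar z = T⁻¹ * ∫ s in (0 : ℝ)..T, F₄ (flowMod Φ (s, z)) := by
      intro z
      rw [hAbardef]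
      simp only [hF4eq]
      rw [intervalIntegral.integral_const_mul]
      ring
    simp only [e1]
    exact hKT.trans hrem
  -- (3) the Koopman tolerance and the sample threshold
  set B : ℝ := 4 * ((N + 1) * (κ / 4) + (N + 1) * (κ / 4)) with hBdef
  have hε₀pos : 0 < η / (4 * Real.exp B) := by positivity
  have hε₀ : (0 : ℝ≥0∞) < ENNReal.ofReal (η / (4 * Real.exp B)) := ENNReal.ofReal_pos.2 hε₀pos
  obtain ⟨u₁, hu₁, hmod⟩ := exists_shift_modulus Φ G hgood hFc hFb hε₀
  refine ⟨⌈T / u₁⌉₊ + 1, by omega, fun n hn => ?_⟩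
  have hn1 : 1 ≤ n := le_trans (by omega) hn
  have hn_pos : (0 : ℝ) < n := by exact_mod_cast hn1
  have hTn : T / n ≤ u₁ := by
    have h1 : ((⌈T / u₁⌉₊ : ℕ) : ℝ) ≤ n := by exact_mod_cast (Nat.le_succ _).trans hn
    have h2 : T / u₁ ≤ n := (Nat.le_ceil _).trans h1
    rw [div_le_iff₀ hn_pos]
    rw [div_le_iff₀ hu₁] at h2
    linarith
  -- the shift modulus on the modified flow, for all right shifts by at most `T/n`
  have hεm : ∀ t u : ℝ, 0 ≤ u → u ≤ t → t ≤ u + T / n →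
      ∫⁻ z, ENNReal.ofReal |F (flowMod Φ (t, z)) - F (flowMod Φ (u, z))| ∂G ≤ ENNReal.ofReal (η / (4 * Real.exp B)) := by
    intro t u _ hut htu
    rw [show t = (t - u) + u by ring, lintegral_abs_sub_shift_semigroup (flowMod Φ) hθmt (flowMod_add Φ) G hinvm hFm]
    have e1 : ∫⁻ z, ENNReal.ofReal |F (flowMod Φ (t - u, z)) - F z| ∂G =
        ∫⁻ z, ENNReal.ofReal |F (Φ.flow (t - u) z) - F z| ∂G := by
      refine lintegral_congr_ae ?_
      filter_upwards [hae] with z hz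
      rw [flowMod_of_mem Φ hz]
    rw [e1]
    exact hmod (t - u) ⟨sub_nonneg.2 hut, by linarith⟩
  -- (4) the sampling error `Y = 4 (A_n − Ā)`
  set A : Phase N → ℝ := discAvg Φ F n (T / n) with hAdef
  have hAm : Measurable A := measurable_discAvg Φ hFm n _
  set Y : Phase N → ℝ := fun z => 2 * (2 * (A z - Abar z)) with hYdef
  have hYm : Measurable Y := ((hAm.sub hAbarm).const_mul 2).const_mul 2
  have hYb : ∀ z, |Y z| ≤ B := by
    intro z
    have h1 : |A z| ≤ (N + 1) * (κ / 4) := abs_discAvg_le Φ hFb hn1 (T / n) z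
    have h2 := hAbarb z
    rw [hYdef, hBdef]
    simp only
    rw [abs_mul, abs_mul, abs_two]
    have h3 := abs_sub (A z) (Abar z)
    linarith
  have hL1 : ∫⁻ z, ENNReal.ofReal |A z - Abar z| ∂G ≤ ENNReal.ofReal (η / (4 * Real.exp B)) := by
    have e1 : ∫⁻ z, ENNReal.ofReal |A z - Abar z| ∂G = ∫⁻ z, ENNReal.ofReal
        |(n : ℝ)⁻¹ * ∑ j : Fin n, F (flowMod Φ ((((j : ℕ) : ℝ) + 1) * (T / n), z)) -
          T⁻¹ * ∫ s in (0 : ℝ)..T, F (flowMod Φ (s, z))| ∂G := by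
      refine lintegral_congr_ae ?_
      filter_upwards [hae] with z hz
      simp only [hAdef, hAbardef, discAvg, flowMod_of_mem Φ hz]
    rw [e1]
    exact lintegral_abs_discAvg_sub_window_le (flowMod Φ) hθm G hFm hFb hT hn1 hεm
  have hYint : ∫⁻ z, ENNReal.ofReal |Y z| ∂G ≤ 4 * ENNReal.ofReal (η / (4 * Real.exp B)) := by
    have e1 : ∀ z, ENNReal.ofReal |Y z| = 4 * ENNReal.ofReal |A z - Abar z| := by
      intro z
      rw [hYdef]
      simp only
      rw [← mul_assoc, show (2 : ℝ) * 2 = 4 by norm_num, abs_mul, abs_of_pos (by norm_num : (0 : ℝ) < 4),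
        ENNReal.ofReal_mul (by norm_num : (0 : ℝ) ≤ 4), ENNReal.ofReal_ofNat]
    simp only [e1]
    have hmeas : Measurable fun z => ENNReal.ofReal |A z - Abar z| := (hAm.sub hAbarm).abs.ennreal_ofReal
    rw [lintegral_const_mul _ hmeas]
    exact mul_le_mul' le_rfl hL1
  have hYexp : ∫⁻ z, ENNReal.ofReal (Real.exp (Y z)) ∂G ≤ E := by
    refine (lintegral_exp_le_one_add hYm hYb).trans ?_
    have h1 : ENNReal.ofReal (Real.exp B) * ∫⁻ z, ENNReal.ofReal |Y z| ∂G ≤ ENNReal.ofReal η := by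
      refine (mul_le_mul' le_rfl hYint).trans ?_
      rw [← ENNReal.ofReal_ofNat, ← ENNReal.ofReal_mul (by norm_num : (0 : ℝ) ≤ 4),
        ← ENNReal.ofReal_mul (Real.exp_nonneg _)]
      refine ENNReal.ofReal_le_ofReal (le_of_eq ?_)
      field_simp
    calc 1 + ENNReal.ofReal (Real.exp B) * ∫⁻ z, ENNReal.ofReal |Y z| ∂G
        ≤ 1 + ENNReal.ofReal η := add_le_add le_rfl h1
      _ = ENNReal.ofReal (η + 1) := by rw [ENNReal.ofReal_add hη.le zero_le_one, ENNReal.ofReal_one, add_comm]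
      _ ≤ E := by
          refine ENNReal.ofReal_le_ofReal ((Real.add_one_le_exp η).trans (Real.exp_le_exp.2 ?_))
          have hN0 : (0 : ℝ) ≤ N := Nat.cast_nonneg N
          have hηN : 0 ≤ η * N := mul_nonneg hη.le hN0
          linarith
  -- (5) Cauchy–Schwarz and assembly
  have hfinal : ∫⁻ z, ENNReal.ofReal (Real.exp (2 * A z)) ∂G ≤ E := by
    have e1 : ∀ z, 2 * A z = 2 * Abar z + 2 * (A z - Abar z) := fun z => by ring
    simp only [e1]
    refine (lintegral_exp_add_le (hAbarm.const_mul 2) ((hAm.sub hAbarm).const_mul 2)).trans ?_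
    have e2 : ∀ z, 2 * (2 * Abar z) = 4 * Abar z := fun z => by ring
    simp only [e2]
    calc (∫⁻ z, ENNReal.ofReal (Real.exp (4 * Abar z)) ∂G) ^ (1 / 2 : ℝ) *
          (∫⁻ z, ENNReal.ofReal (Real.exp (Y z)) ∂G) ^ (1 / 2 : ℝ)
        ≤ E ^ (1 / 2 : ℝ) * E ^ (1 / 2 : ℝ) :=
          mul_le_mul' (ENNReal.rpow_le_rpow hA4 (by norm_num)) (ENNReal.rpow_le_rpow hYexp (by norm_num))
      _ = E := by
          rw [← ENNReal.rpow_add_of_nonneg _ _ (by norm_num) (by norm_num)]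
          norm_num
  -- back to the Bochner integral
  rw [integral_eq_lintegral_of_nonneg_ae (ae_of_all _ fun z => (Real.exp_pos _).le)
    ((hAm.const_mul 2).exp.aestronglyMeasurable)]
  exact ENNReal.toReal_le_of_le_ofReal (Real.exp_pos _).le hfinal

end Main

/-! ## Unconditional corollaries (stub 2 is a landed tree theorem) -/

section Corollaries

/-- Stub 2 of the line (`OneBodyEntropyBudget`, drefute gen 2's verbatim copy) HOLDS: it is the lead's landed tree theorem
`KineticEntropyCollisionBudget.stub_oneBodyEntropyBudget` (`Theorems/AntiMazurCoboundariesCorrectorPressureDecayEntropyBudget.lean`). [folklore] -/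
theorem oneBodyEntropyBudget_holds : OneBodyEntropyBudget := by
  intro σ a θ u₀ hσ hσ2 ha hθ N Φ n lag hn P hP
  exact Summit.AtomisticToContinuum.HydrodynamicLimit.Theorems.KineticEntropyCollisionBudget.stub_oneBodyEntropyBudget
    σ a θ u₀ hσ hσ2 ha hθ N Φ n lag hn P hP _ rfl

/-- **The line's open stub is implied by the crux, unconditionally**: `CorrectorPressureDecay → FastSectorDominance`. With the
skeleton's sorry-free composition (all other stubs landed) `FastSectorDominance ↔ CorrectorPressureDecay`: stub 5 IS the crux. [folklore] -/
theorem fastSectorDominance_of_correctorPressureDecay'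
    (hX : Summit.AtomisticToContinuum.HydrodynamicLimit.Theses.AntiMazurCoboundaries.CorrectorPressureDecay) :
    FastSectorDominance :=
  fastSectorDominance_of_correctorPressureDecay oneBodyEntropyBudget_holds hX

/-- **The line's open stub is implied by the shared wall, unconditionally**: `KineticFluxLdDecay → FastSectorDominance`
(drefute gen 2's sandwich with its paper step replaced by `discreteWindowPressureDecay_of_kineticFluxLdDecay`). [folklore] -/
theorem fastSectorDominance_of_kineticFluxLdDecay
    (h : Summit.AtomisticToContinuum.HydrodynamicLimit.Theses.AntiMazurCoboundaries.KineticFluxLdDecay) :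
    FastSectorDominance :=
  fastSectorDominance_of_discreteWindowPressureDecay oneBodyEntropyBudget_holds
    (discreteWindowPressureDecay_of_kineticFluxLdDecay h)

end Corollaries

end Summit.AtomisticToContinuum.HydrodynamicLimit.Theorems.CorrectorPressureDecayNegative.DiscreteWindow

end
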